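import Mathlib

/-!
# `GapToContinuum` (stmt-QuantumFields-8896) — negative-side support: heavy kets are not closed under
# products (the "sandwich leak"), a kernel-checked three-level transfer-matrix witness

Support file for the crux `GapToContinuum` of routes `LangevinControlUV` / `OneCertifiedCube`
(`IsYangMillsFor r sch T → HasLatticeMassGap r sch Δ → T.HasMassGap Δ`), from the standing disprover
(`Cruxes/GapToContinuum/Disproof.lean` §4). It certifies, at the abstract transfer-matrix level on which
the crux's informal proof sketch lives ("via the reflection-positive transfer matrix at each k: spectrum of
`e^{-a_k H}` in `{1} ∪ [0, e^{-a_k Δ}]` on the full lattice Hilbert space"), WHY the quantifier shape of the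
hypothesis `HasLatticeMassGap` (`∀ A B, ∃ C, ∀ᶠ k, …`: clustering per PAIR of local observables, with a
pair-dependent threshold) is load-bearing-ly weak.

Read through a positive transfer matrix `T` with vacuum `Ω`, the diagonal clause of `HasLatticeMassGap`
for an observable `A` says that the ket `ÂΩ` CLUSTERS at rate `q = e^{-Δ a_k}`:
`∃ C, ∀ t, |⟪ÂΩ, Tᵗ ÂΩ⟫ - ⟪ÂΩ, Ω⟫⟪Ω, ÂΩ⟫| ≤ C qᵗ`. The OS vectors whose clustering `T.HasMassGap Δ`
demands in arity `n ≥ 2` are lattice limits of MULTI-insertion kets `Â Tˢ B̂ Ω` (smeared two-leg vectors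
are sums over bilocal species `A · τ_z B` with unboundedly many displacements `z` at each step `k`, each
bilocal species carrying its OWN threshold). The natural strengthening that would make the crux
"transfer-matrix bookkeeping" is

* `HeavyKetsProductClosed`: for a symmetric positive-semidefinite contraction `T` fixing the unit vector
  `Ω` and a symmetric observable `A`, if `AΩ` clusters at rate `q ∈ (0,1)` then so does every sandwich
  ket `A Tˢ A Ω` (`s ≥ 0`; `s = 0` is the product ket `A²Ω`).

It is FALSE (`not_heavyKetsProductClosed`, statement written out in full; no definition is introduced —
this is a pure proof file), with the three-level witness
`T = diag(1, 1/4, 1/2)` (vacuum, heavy, light), `Ω = e₀`, `A = e₀e₁ᵀ + e₁e₀ᵀ + e₁e₂ᵀ + e₂e₁ᵀ`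
(couples vacuum ↔ heavy and heavy ↔ light, never vacuum ↔ light): `AΩ = e₁` clusters at rate `1/4`
with constant `1`, while `A Tˢ A Ω = 4⁻ˢ (e₀ + e₂)` has connected function `16⁻ˢ · 2⁻ᵗ`, which is not
`O(4⁻ᵗ)` — for EVERY `s` (`toy_sandwich_not_clusters`). So positivity + spectral calculus + clustering
of the generator kets never yields clustering of product / sandwich kets: any proof of the crux must invoke
the threshold of every product species it meets (an unbounded family at each `k`, which `∀ A B ∃ C ∀ᶠ k`
does not make uniform), or Wilson-specific dynamics (a correlation inequality making the good class
product-closed — available for `ℤ₂`/`U(1)` via Griffiths/FKG, Glimm–Jaffe Thm. 16.1.1, not for a general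
compact `G`). Companion: the per-pair-CONSTANT obstruction
`LatticeGapOnTrajectory.Negative.perPair_clustering_does_not_transfer` (signed combinations; evaded by
reflection positivity on diagonal pairs) — the present witness is the THRESHOLD / product obstruction,
which reflection positivity does not evade.

The toy lemmas take the witness as parameters pinned by defining equations (`hT : T = …`, …) so that no
notation or definition is needed. Mathlib only; `lean check`: rc 0, 0 sorries, axioms standard.
-/

noncomputable section

namespace Summit.QuantumFields.YangMills.Theorems.GapToContinuum.Negative

open Matrix Finset

section Toy

variable {T A : Matrix (Fin 3) (Fin 3) ℝ} {Ω : Fin 3 → ℝ}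
  (hT : T = diagonal ![1, 1 / 4, 1 / 2]) (hA : A = !![0, 1, 0; 1, 0, 1; 0, 1, 0])
  (hΩ : Ω = ![1, 0, 0])

include hT in
/-- `T` is symmetric. [folklore] -/
theorem toyT_isSymm : T.IsSymm := by
  subst hT
  exact diagonal_transpose _

include hA in
/-- `A` is symmetric. [folklore] -/
theorem toyA_isSymm : A.IsSymm := by
  subst hA
  unfold Matrix.IsSymm
  ext i j
  fin_cases i <;> fin_cases j <;> rfl

include hT in
/-- `T ≥ 0`. [folklore] -/
theorem toyT_posSemidef : T.PosSemidef := by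
  subst hT
  rw [posSemidef_diagonal_iff]
  intro i
  fin_cases i <;> norm_num

include hT in
/-- `1 - T` is diagonal with entries `0, 3/4, 1/2`. [folklore] -/
theorem one_sub_toyT : 1 - T = diagonal ![0, 3 / 4, 1 / 2] := by
  subst hT
  ext i j
  fin_cases i <;> fin_cases j <;> simp [diagonal] <;> norm_num

include hT in
/-- `T ≤ 1`. [folklore] -/
theorem one_sub_toyT_posSemidef : (1 - T).PosSemidef := by
  rw [one_sub_toyT hT, posSemidef_diagonal_iff]
  intro i
  fin_cases i <;> norm_num

include hT in
/-- Powers of `T`. [folklore] -/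
theorem toyT_pow (t : ℕ) : T ^ t = diagonal ![1, (1 / 4) ^ t, (1 / 2) ^ t] := by
  subst hT
  rw [diagonal_pow]
  congr 1
  ext i
  fin_cases i <;> simp

include hT hΩ in
/-- `T Ω = Ω`. [folklore] -/
theorem toyT_mulVec_Ω : T *ᵥ Ω = Ω := by
  subst hT hΩ
  ext i
  fin_cases i <;> simp [mulVec_diagonal]

include hΩ in
/-- `‖Ω‖ = 1`. [folklore] -/
theorem toyΩ_dot : Ω ⬝ᵥ Ω = 1 := by
  subst hΩ
  simp [dotProduct, Fin.sum_univ_three]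

include hA hΩ in
/-- The one-insertion ket: `AΩ = e₁` (purely heavy). [folklore] -/
theorem toyA_mulVec_Ω : A *ᵥ Ω = ![0, 1, 0] := by
  subst hA hΩ
  ext i
  fin_cases i <;> simp [mulVec, dotProduct, Fin.sum_univ_three]

include hT hA hΩ in
/-- The sandwich ket: `A Tˢ A Ω = 4⁻ˢ (e₀ + e₂)` (vacuum + LIGHT). [folklore] -/
theorem toy_sandwich (s : ℕ) : A *ᵥ ((T ^ s) *ᵥ (A *ᵥ Ω)) = ![(1 / 4) ^ s, 0, (1 / 4) ^ s] := by
  rw [toyA_mulVec_Ω hA hΩ, toyT_pow hT]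
  subst hA
  ext i
  fin_cases i <;> simp [mulVec, dotProduct, Fin.sum_univ_three]

include hT hA hΩ in
/-- `AΩ` clusters at rate `1/4` (constant `1`): its connected function is exactly `4⁻ᵗ`. [folklore] -/
theorem toy_oneInsertion_clusters :
    ∃ C : ℝ, ∀ t : ℕ,
      |(A *ᵥ Ω) ⬝ᵥ (T ^ t) *ᵥ (A *ᵥ Ω) - ((A *ᵥ Ω) ⬝ᵥ Ω) * (Ω ⬝ᵥ (A *ᵥ Ω))| ≤ C * (1 / 4) ^ t := by
  refine ⟨1, fun t => ?_⟩
  rw [toyA_mulVec_Ω hA hΩ, toyT_pow hT]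
  subst hΩ
  simp [dotProduct, Fin.sum_univ_three, mulVec_diagonal]

include hT hA hΩ in
/-- The connected function of the sandwich ket is exactly `16⁻ˢ · 2⁻ᵗ`. [folklore] -/
theorem toy_sandwich_connected (s t : ℕ) :
    (A *ᵥ ((T ^ s) *ᵥ (A *ᵥ Ω))) ⬝ᵥ (T ^ t) *ᵥ (A *ᵥ ((T ^ s) *ᵥ (A *ᵥ Ω))) -
        ((A *ᵥ ((T ^ s) *ᵥ (A *ᵥ Ω))) ⬝ᵥ Ω) * (Ω ⬝ᵥ (A *ᵥ ((T ^ s) *ᵥ (A *ᵥ Ω)))) =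
      ((1 / 4) ^ s) ^ 2 * (1 / 2) ^ t := by
  rw [toy_sandwich hT hA hΩ, toyT_pow hT]
  subst hΩ
  simp [dotProduct, Fin.sum_univ_three, mulVec_diagonal]
  ring

include hT hA hΩ in
/-- **The leak**: for EVERY `s`, the sandwich ket `A Tˢ A Ω` does not cluster at rate `1/4`. [folklore] -/
theorem toy_sandwich_not_clusters (s : ℕ) :
    ¬ ∃ C : ℝ, ∀ t : ℕ,
      |(A *ᵥ ((T ^ s) *ᵥ (A *ᵥ Ω))) ⬝ᵥ (T ^ t) *ᵥ (A *ᵥ ((T ^ s) *ᵥ (A *ᵥ Ω))) -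
          ((A *ᵥ ((T ^ s) *ᵥ (A *ᵥ Ω))) ⬝ᵥ Ω) * (Ω ⬝ᵥ (A *ᵥ ((T ^ s) *ᵥ (A *ᵥ Ω))))| ≤
        C * (1 / 4) ^ t := by
  rintro ⟨C, hC⟩
  -- `16⁻ˢ 2⁻ᵗ ≤ C 4⁻ᵗ` for all `t`, i.e. `2ᵗ ≤ C 16ˢ`: impossible
  obtain ⟨t, ht⟩ := pow_unbounded_of_one_lt (C * 16 ^ s) (by norm_num : (1 : ℝ) < 2)
  have h := hC t
  rw [toy_sandwich_connected hT hA hΩ] at h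
  have h16 : (0 : ℝ) < 16 ^ s := by positivity
  have h4 : (0 : ℝ) < 4 ^ t := by positivity
  have hpos : 0 ≤ ((1 / 4 : ℝ) ^ s) ^ 2 * (1 / 2) ^ t := by positivity
  rw [abs_of_nonneg hpos] at h
  -- multiply through by `16ˢ 4ᵗ`
  have key : (2 : ℝ) ^ t ≤ C * 16 ^ s := by
    have h1 : ((1 / 4 : ℝ) ^ s) ^ 2 * 16 ^ s = 1 := by
      rw [← pow_mul, mul_comm s 2, pow_mul, ← mul_pow]; norm_num
    have h2 : ((1 : ℝ) / 2) ^ t * 4 ^ t = 2 ^ t := by rw [← mul_pow]; norm_num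
    have e1 : ((1 / 4 : ℝ) ^ s) ^ 2 * (1 / 2) ^ t * (16 ^ s * 4 ^ t) = 2 ^ t := by
      calc ((1 / 4 : ℝ) ^ s) ^ 2 * (1 / 2) ^ t * (16 ^ s * 4 ^ t)
          = (((1 / 4 : ℝ) ^ s) ^ 2 * 16 ^ s) * ((1 / 2) ^ t * 4 ^ t) := by ring
        _ = 2 ^ t := by rw [h1, h2, one_mul]
    have e2 : C * (1 / 4 : ℝ) ^ t * (16 ^ s * 4 ^ t) = C * 16 ^ s := by
      have : ((1 : ℝ) / 4) ^ t * 4 ^ t = 1 := by rw [← mul_pow]; norm_num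
      calc C * (1 / 4 : ℝ) ^ t * (16 ^ s * 4 ^ t) = C * 16 ^ s * ((1 / 4) ^ t * 4 ^ t) := by ring
        _ = C * 16 ^ s := by rw [this, mul_one]
    have := mul_le_mul_of_nonneg_right h (le_of_lt (mul_pos h16 h4))
    rwa [e1, e2] at this
  linarith

end Toy

/-- **`HeavyKetsProductClosed` is false**: for finite-dimensional symmetric positive-semidefinite
contractions `T` (transfer matrices) fixing a unit vacuum `Ω` and symmetric observables `A`, clustering
of the one-insertion ket `AΩ` at rate `q ∈ (0,1)` (`∃ C, ∀ t, |⟪AΩ, Tᵗ AΩ⟫ - ⟪AΩ, Ω⟫⟪Ω, AΩ⟫| ≤ C qᵗ`)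
does NOT propagate to the sandwich / product kets `A Tˢ A Ω` (refuted by the three-level witness at
`s = 0`, the product ket `A²Ω`, and indeed at every `s`). Consequence for the crux: per-observable lattice
clustering (`HasLatticeMassGap`, thresholds per pair) controls the `n = m = 1` sector of
`T.HasMassGap Δ` only; the multi-leg sectors need the thresholds of all product species met along the
way, uniformly in the step — information the hypothesis as typed does not carry. [folklore] -/
theorem not_heavyKetsProductClosed :
    ¬ ∀ (n : ℕ) (T A : Matrix (Fin n) (Fin n) ℝ) (Ω : Fin n → ℝ) (q : ℝ),
      T.IsSymm → T.PosSemidef → (1 - T).PosSemidef → A.IsSymm → T *ᵥ Ω = Ω → Ω ⬝ᵥ Ω = 1 →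
      0 < q → q < 1 →
      (∃ C : ℝ, ∀ t : ℕ, |(A *ᵥ Ω) ⬝ᵥ (T ^ t) *ᵥ (A *ᵥ Ω) - ((A *ᵥ Ω) ⬝ᵥ Ω) * (Ω ⬝ᵥ (A *ᵥ Ω))| ≤
        C * q ^ t) →
      ∀ s : ℕ, ∃ C : ℝ, ∀ t : ℕ,
        |(A *ᵥ ((T ^ s) *ᵥ (A *ᵥ Ω))) ⬝ᵥ (T ^ t) *ᵥ (A *ᵥ ((T ^ s) *ᵥ (A *ᵥ Ω))) -
            ((A *ᵥ ((T ^ s) *ᵥ (A *ᵥ Ω))) ⬝ᵥ Ω) * (Ω ⬝ᵥ (A *ᵥ ((T ^ s) *ᵥ (A *ᵥ Ω))))| ≤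
          C * q ^ t := fun h =>
  toy_sandwich_not_clusters rfl rfl rfl 0
    (h 3 (diagonal ![1, 1 / 4, 1 / 2]) !![0, 1, 0; 1, 0, 1; 0, 1, 0] ![1, 0, 0] (1 / 4)
      (toyT_isSymm rfl) (toyT_posSemidef rfl) (one_sub_toyT_posSemidef rfl) (toyA_isSymm rfl)
      (toyT_mulVec_Ω rfl rfl) (toyΩ_dot rfl) (by norm_num) (by norm_num)
      (toy_oneInsertion_clusters rfl rfl rfl) 0)

/-- The same witness refutes the weaker closure "one transfer step in between" (`s = 1` only): even the
ket `A T A Ω`, one lattice time-step inside the sandwich, leaks into the light level. [folklore] -/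
theorem not_heavyKetsSandwichClosed_one :
    ¬ ∀ (n : ℕ) (T A : Matrix (Fin n) (Fin n) ℝ) (Ω : Fin n → ℝ) (q : ℝ),
      T.IsSymm → T.PosSemidef → (1 - T).PosSemidef → A.IsSymm → T *ᵥ Ω = Ω → Ω ⬝ᵥ Ω = 1 →
      0 < q → q < 1 →
      (∃ C : ℝ, ∀ t : ℕ, |(A *ᵥ Ω) ⬝ᵥ (T ^ t) *ᵥ (A *ᵥ Ω) - ((A *ᵥ Ω) ⬝ᵥ Ω) * (Ω ⬝ᵥ (A *ᵥ Ω))| ≤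
        C * q ^ t) →
      ∃ C : ℝ, ∀ t : ℕ,
        |(A *ᵥ ((T ^ 1) *ᵥ (A *ᵥ Ω))) ⬝ᵥ (T ^ t) *ᵥ (A *ᵥ ((T ^ 1) *ᵥ (A *ᵥ Ω))) -
            ((A *ᵥ ((T ^ 1) *ᵥ (A *ᵥ Ω))) ⬝ᵥ Ω) * (Ω ⬝ᵥ (A *ᵥ ((T ^ 1) *ᵥ (A *ᵥ Ω))))| ≤
          C * q ^ t := fun h =>
  toy_sandwich_not_clusters rfl rfl rfl 1
    (h 3 (diagonal ![1, 1 / 4, 1 / 2]) !![0, 1, 0; 1, 0, 1; 0, 1, 0] ![1, 0, 0] (1 / 4)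
      (toyT_isSymm rfl) (toyT_posSemidef rfl) (one_sub_toyT_posSemidef rfl) (toyA_isSymm rfl)
      (toyT_mulVec_Ω rfl rfl) (toyΩ_dot rfl) (by norm_num) (by norm_num)
      (toy_oneInsertion_clusters rfl rfl rfl))

end Summit.QuantumFields.YangMills.Theorems.GapToContinuum.Negative

end
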